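import Mathlib
import HarnessLib
import Summits.ValiantsHypothesis.ValiantsHypothesis.Theorems.LacunarySymmetroidMatrixDescartesOsculationLawRankThreeColumn
import Summits.ValiantsHypothesis.ValiantsHypothesis.Theorems.LacunarySymmetroidMatrixDescartesOsculationLawCuspQuartic
import Summits.ValiantsHypothesis.ValiantsHypothesis.Theorems.LacunarySymmetroidMatrixDescartesOsculationLawCuspQuarticReduction
import Summits.ValiantsHypothesis.ValiantsHypothesis.Theorems.LacunarySymmetroidMatrixDescartesOsculationLawCuspQuarticSupportHigh
import Summits.ValiantsHypothesis.ValiantsHypothesis.Theorems.LacunarySymmetroidMatrixDescartesOsculationLawCuspQuarticSupportLow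
import Summits.ValiantsHypothesis.ValiantsHypothesis.Theorems.LacunarySymmetroidMatrixDescartesOsculationLawCuspQuarticCount

/-!
# ValiantsHypothesis / LacunarySymmetroid — crux `MatrixDescartes` (stmt-ValiantsHypothesis-18050, V1),
# line «osculation-law»: the `(4, 0)` splitting of the `m = 4` rung — the MONIC QUARTIC letter, counted

For the splitting `(r, s) = (4, 0)` of `OsculationLawAt 4 K ·` — the full-rank semidefinite letter `b·I₄` inserted
into a symmetric `4 × 4` pencil `G(t) = Σ_l t^(d l) S_l` — the insertion polynomial is the MONIC QUARTIC
`det(G + b I₄) = b⁴ + σ₁b³ + σ₂b² + σ₃b + σ₄` (`OsculationLetter.insertionPoly_rank_card` with `r = 4`, `s = 0`: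
`σₖ` = sums of principal cofactors, `supp σₖ ⊆ k•E` by `supp_coeff_card`, top coefficient `det` of the empty block
`= 1`), real-rooted at every `t` (`prod_roots_pencil_rank_card`, symmetric pencil).  Feeding the θ-calculus
(`OsculationCuspQuartic.eval_Phi4`, `eval_logHessian_Phi4`), the certified reduction `hess_reduce_poly4`
(`H = R₃b³ + R₂b² + R₁b + R₀` on the curve), the remainder supports (`supp_R3q … supp_R0q ⊆ (9,10,11,12)•E`) and the
assembled count `quartic_curve_ncard_le_pow` gives, for every `K`, `d`, symmetric `S`:

  `osc_four_zero (K d S) : … (osculation set finite) → #osc ≤ 22 · K ^ 124`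

(the line's `osculationSet d S` for `Fin 4 ⊕ Fin 0`, UNFOLDED verbatim as in `OsculationRankThree.osc_three_s`).
With val-lit-p5 g11's columns `osc_three_s 1` (`(3,1)`), the rank-two / rank-one / rank-zero columns, this is the last
piece of the `m = 4` rung `osculationLawAt_four` (assembly = `interval_cases r`, as `osculationLawAt_three`).
Honest framing: a located PIECE of an UNREGISTERED V1 law line with a Descartes ceiling; `OsculationLaw` (all `m`),
`PeelInequality`, `stub_recursion`, `MatrixDescartes`, Conjecture B and `VP ≠ VNP` stay OPEN / NOT proved.
No definitions, no named facts; Mathlib + tree osculation files.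
-/

-- `Summit.ValiantsHypothesis.ValiantsHypothesis.…` is the tree's mandated single-conjunct layout (Sub = Summit).
set_option linter.dupNamespace false

-- the count and the reduction carry explicit polynomials of ≈ 100 terms (deep terms)
set_option maxRecDepth 100000

noncomputable section

namespace Summit.ValiantsHypothesis.ValiantsHypothesis.Theorems.LacunarySymmetroidMatrixDescartes

open Polynomial Set
open scoped BigOperators Pointwise

namespace OsculationFourK

open OsculationCusp OsculationTwoK OsculationLetter OsculationRankTwo OsculationCuspCubic OsculationCuspQuartic

-- the proof instantiates the quartic reduction and count with the explicit `R₃, R₂, R₁, R₀`.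
set_option maxHeartbeats 3200000 in
/-- **The `(4,0)` splitting of the `m = 4` rung of the osculation law.**  For every `K`, every exponent vector `d`
and every symmetric pencil `S : Fin K → Matrix (Fin 4 ⊕ Fin 0) (Fin 4 ⊕ Fin 0) ℝ`: if the osculation set of the
spectral curve `det(Σ_l t^(d l) S_l + b·I₄) = 0` (the line's `osculationSet d S`, UNFOLDED verbatim) is finite, it has
at most `22 · K ^ 124` points. -/
theorem osc_four_zero (K : ℕ) (d : Fin K → ℕ) (S : Fin K → Matrix (Fin 4 ⊕ Fin 0) (Fin 4 ⊕ Fin 0) ℝ)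
    (hS : ∀ l, (S l).IsSymm) (hfin : {p : Fin 2 → ℝ | 0 < p 0 ∧ 0 < p 1 ∧ MvPolynomial.eval p (∑ l, (MvPolynomial.X (0 : Fin 2) : MvPolynomial (Fin 2) ℝ) ^ d l •
              (S l).map (MvPolynomial.C : ℝ →+* MvPolynomial (Fin 2) ℝ)
            + (MvPolynomial.X (1 : Fin 2) : MvPolynomial (Fin 2) ℝ) •
              (Matrix.fromBlocks 1 0 0 0 : Matrix (Fin 4 ⊕ Fin 0) (Fin 4 ⊕ Fin 0) ℝ).map
                (MvPolynomial.C : ℝ →+* MvPolynomial (Fin 2) ℝ)).det = 0 ∧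
      MvPolynomial.eval p
        (MvPolynomial.X 0 * MvPolynomial.pderiv 0 (MvPolynomial.X 0 * MvPolynomial.pderiv 0 (∑ l, (MvPolynomial.X (0 : Fin 2) : MvPolynomial (Fin 2) ℝ) ^ d l •
              (S l).map (MvPolynomial.C : ℝ →+* MvPolynomial (Fin 2) ℝ)
            + (MvPolynomial.X (1 : Fin 2) : MvPolynomial (Fin 2) ℝ) •
              (Matrix.fromBlocks 1 0 0 0 : Matrix (Fin 4 ⊕ Fin 0) (Fin 4 ⊕ Fin 0) ℝ).map
                (MvPolynomial.C : ℝ →+* MvPolynomial (Fin 2) ℝ)).det)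
            * (MvPolynomial.X 1 * MvPolynomial.pderiv 1 (∑ l, (MvPolynomial.X (0 : Fin 2) : MvPolynomial (Fin 2) ℝ) ^ d l •
              (S l).map (MvPolynomial.C : ℝ →+* MvPolynomial (Fin 2) ℝ)
            + (MvPolynomial.X (1 : Fin 2) : MvPolynomial (Fin 2) ℝ) •
              (Matrix.fromBlocks 1 0 0 0 : Matrix (Fin 4 ⊕ Fin 0) (Fin 4 ⊕ Fin 0) ℝ).map
                (MvPolynomial.C : ℝ →+* MvPolynomial (Fin 2) ℝ)).det) ^ 2
          - 2 * (MvPolynomial.X 0 * MvPolynomial.pderiv 0 (MvPolynomial.X 1 * MvPolynomial.pderiv 1 (∑ l, (MvPolynomial.X (0 : Fin 2) : MvPolynomial (Fin 2) ℝ) ^ d l •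
              (S l).map (MvPolynomial.C : ℝ →+* MvPolynomial (Fin 2) ℝ)
            + (MvPolynomial.X (1 : Fin 2) : MvPolynomial (Fin 2) ℝ) •
              (Matrix.fromBlocks 1 0 0 0 : Matrix (Fin 4 ⊕ Fin 0) (Fin 4 ⊕ Fin 0) ℝ).map
                (MvPolynomial.C : ℝ →+* MvPolynomial (Fin 2) ℝ)).det))
            * (MvPolynomial.X 0 * MvPolynomial.pderiv 0 (∑ l, (MvPolynomial.X (0 : Fin 2) : MvPolynomial (Fin 2) ℝ) ^ d l •
              (S l).map (MvPolynomial.C : ℝ →+* MvPolynomial (Fin 2) ℝ)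
            + (MvPolynomial.X (1 : Fin 2) : MvPolynomial (Fin 2) ℝ) •
              (Matrix.fromBlocks 1 0 0 0 : Matrix (Fin 4 ⊕ Fin 0) (Fin 4 ⊕ Fin 0) ℝ).map
                (MvPolynomial.C : ℝ →+* MvPolynomial (Fin 2) ℝ)).det) * (MvPolynomial.X 1 * MvPolynomial.pderiv 1 (∑ l, (MvPolynomial.X (0 : Fin 2) : MvPolynomial (Fin 2) ℝ) ^ d l •
              (S l).map (MvPolynomial.C : ℝ →+* MvPolynomial (Fin 2) ℝ)
            + (MvPolynomial.X (1 : Fin 2) : MvPolynomial (Fin 2) ℝ) •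
              (Matrix.fromBlocks 1 0 0 0 : Matrix (Fin 4 ⊕ Fin 0) (Fin 4 ⊕ Fin 0) ℝ).map
                (MvPolynomial.C : ℝ →+* MvPolynomial (Fin 2) ℝ)).det)
          + MvPolynomial.X 1 * MvPolynomial.pderiv 1 (MvPolynomial.X 1 * MvPolynomial.pderiv 1 (∑ l, (MvPolynomial.X (0 : Fin 2) : MvPolynomial (Fin 2) ℝ) ^ d l •
              (S l).map (MvPolynomial.C : ℝ →+* MvPolynomial (Fin 2) ℝ)
            + (MvPolynomial.X (1 : Fin 2) : MvPolynomial (Fin 2) ℝ) •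
              (Matrix.fromBlocks 1 0 0 0 : Matrix (Fin 4 ⊕ Fin 0) (Fin 4 ⊕ Fin 0) ℝ).map
                (MvPolynomial.C : ℝ →+* MvPolynomial (Fin 2) ℝ)).det)
            * (MvPolynomial.X 0 * MvPolynomial.pderiv 0 (∑ l, (MvPolynomial.X (0 : Fin 2) : MvPolynomial (Fin 2) ℝ) ^ d l •
              (S l).map (MvPolynomial.C : ℝ →+* MvPolynomial (Fin 2) ℝ)
            + (MvPolynomial.X (1 : Fin 2) : MvPolynomial (Fin 2) ℝ) •
              (Matrix.fromBlocks 1 0 0 0 : Matrix (Fin 4 ⊕ Fin 0) (Fin 4 ⊕ Fin 0) ℝ).map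
                (MvPolynomial.C : ℝ →+* MvPolynomial (Fin 2) ℝ)).det) ^ 2) = 0}.Finite) :
    {p : Fin 2 → ℝ | 0 < p 0 ∧ 0 < p 1 ∧ MvPolynomial.eval p (∑ l, (MvPolynomial.X (0 : Fin 2) : MvPolynomial (Fin 2) ℝ) ^ d l •
              (S l).map (MvPolynomial.C : ℝ →+* MvPolynomial (Fin 2) ℝ)
            + (MvPolynomial.X (1 : Fin 2) : MvPolynomial (Fin 2) ℝ) •
              (Matrix.fromBlocks 1 0 0 0 : Matrix (Fin 4 ⊕ Fin 0) (Fin 4 ⊕ Fin 0) ℝ).map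
                (MvPolynomial.C : ℝ →+* MvPolynomial (Fin 2) ℝ)).det = 0 ∧
      MvPolynomial.eval p
        (MvPolynomial.X 0 * MvPolynomial.pderiv 0 (MvPolynomial.X 0 * MvPolynomial.pderiv 0 (∑ l, (MvPolynomial.X (0 : Fin 2) : MvPolynomial (Fin 2) ℝ) ^ d l •
              (S l).map (MvPolynomial.C : ℝ →+* MvPolynomial (Fin 2) ℝ)
            + (MvPolynomial.X (1 : Fin 2) : MvPolynomial (Fin 2) ℝ) •
              (Matrix.fromBlocks 1 0 0 0 : Matrix (Fin 4 ⊕ Fin 0) (Fin 4 ⊕ Fin 0) ℝ).map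
                (MvPolynomial.C : ℝ →+* MvPolynomial (Fin 2) ℝ)).det)
            * (MvPolynomial.X 1 * MvPolynomial.pderiv 1 (∑ l, (MvPolynomial.X (0 : Fin 2) : MvPolynomial (Fin 2) ℝ) ^ d l •
              (S l).map (MvPolynomial.C : ℝ →+* MvPolynomial (Fin 2) ℝ)
            + (MvPolynomial.X (1 : Fin 2) : MvPolynomial (Fin 2) ℝ) •
              (Matrix.fromBlocks 1 0 0 0 : Matrix (Fin 4 ⊕ Fin 0) (Fin 4 ⊕ Fin 0) ℝ).map
                (MvPolynomial.C : ℝ →+* MvPolynomial (Fin 2) ℝ)).det) ^ 2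
          - 2 * (MvPolynomial.X 0 * MvPolynomial.pderiv 0 (MvPolynomial.X 1 * MvPolynomial.pderiv 1 (∑ l, (MvPolynomial.X (0 : Fin 2) : MvPolynomial (Fin 2) ℝ) ^ d l •
              (S l).map (MvPolynomial.C : ℝ →+* MvPolynomial (Fin 2) ℝ)
            + (MvPolynomial.X (1 : Fin 2) : MvPolynomial (Fin 2) ℝ) •
              (Matrix.fromBlocks 1 0 0 0 : Matrix (Fin 4 ⊕ Fin 0) (Fin 4 ⊕ Fin 0) ℝ).map
                (MvPolynomial.C : ℝ →+* MvPolynomial (Fin 2) ℝ)).det))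
            * (MvPolynomial.X 0 * MvPolynomial.pderiv 0 (∑ l, (MvPolynomial.X (0 : Fin 2) : MvPolynomial (Fin 2) ℝ) ^ d l •
              (S l).map (MvPolynomial.C : ℝ →+* MvPolynomial (Fin 2) ℝ)
            + (MvPolynomial.X (1 : Fin 2) : MvPolynomial (Fin 2) ℝ) •
              (Matrix.fromBlocks 1 0 0 0 : Matrix (Fin 4 ⊕ Fin 0) (Fin 4 ⊕ Fin 0) ℝ).map
                (MvPolynomial.C : ℝ →+* MvPolynomial (Fin 2) ℝ)).det) * (MvPolynomial.X 1 * MvPolynomial.pderiv 1 (∑ l, (MvPolynomial.X (0 : Fin 2) : MvPolynomial (Fin 2) ℝ) ^ d l •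
              (S l).map (MvPolynomial.C : ℝ →+* MvPolynomial (Fin 2) ℝ)
            + (MvPolynomial.X (1 : Fin 2) : MvPolynomial (Fin 2) ℝ) •
              (Matrix.fromBlocks 1 0 0 0 : Matrix (Fin 4 ⊕ Fin 0) (Fin 4 ⊕ Fin 0) ℝ).map
                (MvPolynomial.C : ℝ →+* MvPolynomial (Fin 2) ℝ)).det)
          + MvPolynomial.X 1 * MvPolynomial.pderiv 1 (MvPolynomial.X 1 * MvPolynomial.pderiv 1 (∑ l, (MvPolynomial.X (0 : Fin 2) : MvPolynomial (Fin 2) ℝ) ^ d l •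
              (S l).map (MvPolynomial.C : ℝ →+* MvPolynomial (Fin 2) ℝ)
            + (MvPolynomial.X (1 : Fin 2) : MvPolynomial (Fin 2) ℝ) •
              (Matrix.fromBlocks 1 0 0 0 : Matrix (Fin 4 ⊕ Fin 0) (Fin 4 ⊕ Fin 0) ℝ).map
                (MvPolynomial.C : ℝ →+* MvPolynomial (Fin 2) ℝ)).det)
            * (MvPolynomial.X 0 * MvPolynomial.pderiv 0 (∑ l, (MvPolynomial.X (0 : Fin 2) : MvPolynomial (Fin 2) ℝ) ^ d l •
              (S l).map (MvPolynomial.C : ℝ →+* MvPolynomial (Fin 2) ℝ)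
            + (MvPolynomial.X (1 : Fin 2) : MvPolynomial (Fin 2) ℝ) •
              (Matrix.fromBlocks 1 0 0 0 : Matrix (Fin 4 ⊕ Fin 0) (Fin 4 ⊕ Fin 0) ℝ).map
                (MvPolynomial.C : ℝ →+* MvPolynomial (Fin 2) ℝ)).det) ^ 2) = 0}.ncard ≤ 22 * K ^ 124 := by
  classical
  have hEK : (Finset.univ.image d).card ≤ K := (Finset.card_image_le).trans (by simp)
  -- the top coefficient: determinant of the empty block
  have htop : (∑ l, (X : ℝ[X]) ^ d l • ((S l).toBlocks₂₂).map Polynomial.C).det = 1 := Matrix.det_isEmpty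
  -- the monic quartic letter `Φ = X₁⁴ + X₁³·ι σ₁ + X₁²·ι σ₂ + X₁·ι σ₃ + ι σ₄`
  have hΦ : (∑ l, (MvPolynomial.X (0 : Fin 2) : MvPolynomial (Fin 2) ℝ) ^ d l •
              (S l).map (MvPolynomial.C : ℝ →+* MvPolynomial (Fin 2) ℝ)
            + (MvPolynomial.X (1 : Fin 2) : MvPolynomial (Fin 2) ℝ) •
              (Matrix.fromBlocks 1 0 0 0 : Matrix (Fin 4 ⊕ Fin 0) (Fin 4 ⊕ Fin 0) ℝ).map
                (MvPolynomial.C : ℝ →+* MvPolynomial (Fin 2) ℝ)).det =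
      MvPolynomial.X 1 * MvPolynomial.X 1 * MvPolynomial.X 1 * MvPolynomial.X 1
        + MvPolynomial.X 1 * MvPolynomial.X 1 * MvPolynomial.X 1 * Polynomial.aeval (MvPolynomial.X 0 : MvPolynomial (Fin 2) ℝ)
          (∑ U ∈ (Finset.univ.map Function.Embedding.inl : Finset (Fin 4 ⊕ Fin 0)).powersetCard 3,
          (Matrix.of fun i j : Fin 4 ⊕ Fin 0 => if i ∈ U then (Pi.single i (1 : ℝ[X]) : Fin 4 ⊕ Fin 0 → ℝ[X]) j
            else (∑ l, (X : ℝ[X]) ^ d l • (S l).map Polynomial.C) i j).det)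
        + MvPolynomial.X 1 * MvPolynomial.X 1 * Polynomial.aeval (MvPolynomial.X 0 : MvPolynomial (Fin 2) ℝ)
          (∑ U ∈ (Finset.univ.map Function.Embedding.inl : Finset (Fin 4 ⊕ Fin 0)).powersetCard 2,
          (Matrix.of fun i j : Fin 4 ⊕ Fin 0 => if i ∈ U then (Pi.single i (1 : ℝ[X]) : Fin 4 ⊕ Fin 0 → ℝ[X]) j
            else (∑ l, (X : ℝ[X]) ^ d l • (S l).map Polynomial.C) i j).det)
        + MvPolynomial.X 1 * Polynomial.aeval (MvPolynomial.X 0 : MvPolynomial (Fin 2) ℝ)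
          (∑ U ∈ (Finset.univ.map Function.Embedding.inl : Finset (Fin 4 ⊕ Fin 0)).powersetCard 1,
          (Matrix.of fun i j : Fin 4 ⊕ Fin 0 => if i ∈ U then (Pi.single i (1 : ℝ[X]) : Fin 4 ⊕ Fin 0 → ℝ[X]) j
            else (∑ l, (X : ℝ[X]) ^ d l • (S l).map Polynomial.C) i j).det)
        + Polynomial.aeval (MvPolynomial.X 0 : MvPolynomial (Fin 2) ℝ) (∑ l, (X : ℝ[X]) ^ d l • (S l).map Polynomial.C).det := by
    rw [insertionPoly_rank_card 4 0 d S, Finset.sum_range_succ, Finset.sum_range_succ, Finset.sum_range_succ,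
      Finset.sum_range_succ, Finset.sum_range_succ, Finset.sum_range_zero, coeff_top 4 0 d S, coeff_zero 4 0 d S,
      htop, map_one]
    ring
  -- supports of the four coefficients
  have h1s : (∑ U ∈ (Finset.univ.map Function.Embedding.inl : Finset (Fin 4 ⊕ Fin 0)).powersetCard 3,
          (Matrix.of fun i j : Fin 4 ⊕ Fin 0 => if i ∈ U then (Pi.single i (1 : ℝ[X]) : Fin 4 ⊕ Fin 0 → ℝ[X]) j
            else (∑ l, (X : ℝ[X]) ^ d l • (S l).map Polynomial.C) i j).det).support ⊆ 1 • Finset.univ.image d :=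
    supp_cast (supp_coeff_card 4 0 d S 3) (by norm_num)
  have h2s : (∑ U ∈ (Finset.univ.map Function.Embedding.inl : Finset (Fin 4 ⊕ Fin 0)).powersetCard 2,
          (Matrix.of fun i j : Fin 4 ⊕ Fin 0 => if i ∈ U then (Pi.single i (1 : ℝ[X]) : Fin 4 ⊕ Fin 0 → ℝ[X]) j
            else (∑ l, (X : ℝ[X]) ^ d l • (S l).map Polynomial.C) i j).det).support ⊆ 2 • Finset.univ.image d :=
    supp_cast (supp_coeff_card 4 0 d S 2) (by norm_num)
  have h3s : (∑ U ∈ (Finset.univ.map Function.Embedding.inl : Finset (Fin 4 ⊕ Fin 0)).powersetCard 1,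
          (Matrix.of fun i j : Fin 4 ⊕ Fin 0 => if i ∈ U then (Pi.single i (1 : ℝ[X]) : Fin 4 ⊕ Fin 0 → ℝ[X]) j
            else (∑ l, (X : ℝ[X]) ^ d l • (S l).map Polynomial.C) i j).det).support ⊆ 3 • Finset.univ.image d :=
    supp_cast (supp_coeff_card 4 0 d S 1) (by norm_num)
  have h4s : ((∑ l, (X : ℝ[X]) ^ d l • (S l).map Polynomial.C).det).support ⊆ 4 • Finset.univ.image d :=
    supp_cast (supp_det_pencil d S) (by simp [Fintype.card_sum, Fintype.card_fin])
  -- real-rootedness at every abscissa (symmetric pencil)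
  have hreal : ∀ t : ℝ, ∃ μ₁ μ₂ μ₃ μ₄ : ℝ, ∀ b : ℝ,
      b ^ 4 + b ^ 3 * (∑ U ∈ (Finset.univ.map Function.Embedding.inl : Finset (Fin 4 ⊕ Fin 0)).powersetCard 3,
          (Matrix.of fun i j : Fin 4 ⊕ Fin 0 => if i ∈ U then (Pi.single i (1 : ℝ[X]) : Fin 4 ⊕ Fin 0 → ℝ[X]) j
            else (∑ l, (X : ℝ[X]) ^ d l • (S l).map Polynomial.C) i j).det).eval t
        + b ^ 2 * (∑ U ∈ (Finset.univ.map Function.Embedding.inl : Finset (Fin 4 ⊕ Fin 0)).powersetCard 2,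
          (Matrix.of fun i j : Fin 4 ⊕ Fin 0 => if i ∈ U then (Pi.single i (1 : ℝ[X]) : Fin 4 ⊕ Fin 0 → ℝ[X]) j
            else (∑ l, (X : ℝ[X]) ^ d l • (S l).map Polynomial.C) i j).det).eval t
        + b * (∑ U ∈ (Finset.univ.map Function.Embedding.inl : Finset (Fin 4 ⊕ Fin 0)).powersetCard 1,
          (Matrix.of fun i j : Fin 4 ⊕ Fin 0 => if i ∈ U then (Pi.single i (1 : ℝ[X]) : Fin 4 ⊕ Fin 0 → ℝ[X]) j
            else (∑ l, (X : ℝ[X]) ^ d l • (S l).map Polynomial.C) i j).det).eval t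
        + ((∑ l, (X : ℝ[X]) ^ d l • (S l).map Polynomial.C).det).eval t
        = (b - μ₁) * (b - μ₂) * (b - μ₃) * (b - μ₄) := by
    intro t
    have hD : ((∑ l, (X : ℝ[X]) ^ d l • ((S l).toBlocks₂₂).map Polynomial.C).det).eval t ≠ 0 := by
      rw [htop, eval_one]; exact one_ne_zero
    obtain ⟨μ, hμ⟩ := prod_roots_pencil_rank_card 4 0 d S hS t hD
    refine ⟨μ 0, μ 1, μ 2, μ 3, fun b => ?_⟩
    have := hμ b
    rw [Finset.sum_range_succ, Finset.sum_range_succ, Finset.sum_range_succ, Finset.sum_range_succ,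
      Finset.sum_range_succ, Finset.sum_range_zero, coeff_top 4 0 d S, coeff_zero 4 0 d S, htop, eval_one,
      Fin.prod_univ_four] at this
    linear_combination this
  -- the count (`R₃ … R₀` are inferred from `hess_reduce_poly4` / the support lemmas)
  refine quartic_curve_ncard_le_pow _ hEK h1s h2s h3s h4s
    (supp_R3q _ _ _ _ _ h1s h2s h3s h4s) (supp_R2q _ _ _ _ _ h1s h2s h3s h4s)
    (supp_R1q _ _ _ _ _ h1s h2s h3s h4s) (supp_R0q _ _ _ _ _ h1s h2s h3s h4s)
    (fun p hp => by
      obtain ⟨h0, h1, hΦ0, hH0⟩ := hp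
      rw [hΦ, eval_Phi4] at hΦ0
      rw [eval_logHessian_Phi4 _ _ _ _ _ hΦ] at hH0
      have hred := hess_reduce_poly4 _ _ _ _ (p 0) (p 1) hΦ0
      rw [hH0] at hred
      exact ⟨h0, h1, hΦ0, hred.symm⟩)
    (fun t b ht hb hΦ0 hR => by
      refine ⟨by simpa using ht, by simpa using hb, ?_, ?_⟩
      · rw [hΦ, eval_Phi4]
        simpa using hΦ0
      · rw [eval_logHessian_Phi4 _ _ _ _ _ hΦ]
        simp only [Matrix.cons_val_zero, Matrix.cons_val_one]
        have hred := hess_reduce_poly4 _ _ _ _ t b hΦ0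
        rw [hR] at hred
        exact hred)
    hreal hfin

end OsculationFourK

end Summit.ValiantsHypothesis.ValiantsHypothesis.Theorems.LacunarySymmetroidMatrixDescartes
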